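import Literature.AlgebraicGeometry.Resolution.KnafKuhlmann2009Leaves
import Literature.AlgebraicGeometry.Resolution.Kuhlmann2019Prop52SepClosedHolds
import Literature.AlgebraicGeometry.Resolution.SeparablyDefectlessRationalVTHolds
import Literature.AlgebraicGeometry.Resolution.SeparablyDefectlessRationalRTProofs
import Literature.AlgebraicGeometry.Resolution.GeneralizedStabilityHolds
import HarnessLib

/-!
# Knaf–Kuhlmann 2009, Thm. 1.2 — the named fact `KnafKuhlmann2009` DISCHARGED

Topic: `Literature/AlgebraicGeometry/Resolution` (local uniformization of valued function fields).
H. Knaf, F.-V. Kuhlmann, *Every place admits local uniformization in a finite extension of the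
function field*, Adv. Math. **221** (2009) 428–453 = arXiv:math/0702856, **Theorem 1.2** (§1;
proof in §4.2):

> **Theorem 1.2.** Let `P` be a place of the function field `F|K` and let `Z ⊂ 𝒪_P` be a finite
> set. Let `𝒫` be an extension of `P` to the algebraic closure `F̃` of `F`. Then there exist a
> finite purely inseparable extension `𝒦|K` and a finite separable extension `𝓕|F.𝒦` such that
> the pair `(𝒫|_𝓕, Z)` is smoothly `𝒦`-uniformizable.

The named fact `KnafKuhlmann2009` (`LocalUniformization.lean`) vendors its WEAK consequence: for
every finitely generated `K/k` and every valuation ring `O ⊇ k` of `K` there are a finite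
extension `L/K` and a valuation ring `O'` of `L` lying over `O` that is locally uniformizable
over `k` (`IsLocallyUniformizable`).

This file closes that named fact sorry-free.  The tree reduced it along the printed proofs, every
reduction PROVED:

* §4.2 (Prop. 2.3, Abhyankar subfunction field `F₀`; Prop. 3.2 descent; [KK05] Thm. 1.1 for
  `𝓕₀|K`; composition) and §4.1 (Thm. 1.1 by induction on the transcendence degree over the
  separable-algebraic closure, Lemma 2.1, Prop. 3.10, Prop. 3.4) —
  `KnafKuhlmann2009Thm11.lean`, `KnafKuhlmann2009Prop310.lean`, `KnafKuhlmann2009Prop23.lean`,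
  `FiniteExtensionUniformizationProofs.lean`, `AbhyankarEtaleAscent.lean`;
* Prop. 3.10 = Thm. 3.8 (henselian rationality, [K8] = Kuhlmann 2019, Thm. 1.3) + Lemmas 2.16,
  2.17, 3.7, 3.9 — `KnafKuhlmann2009Lemma216.lean`, `KnafKuhlmann2009HenselianRationality*.lean`,
  `Kuhlmann2019HenselianRationalityFiniteRankAssembly.lean`;
* [KK05] Thm. 3.4 / Thm. 1.1 from the Generalized Stability Theorem [K7] = Kuhlmann 2010,
  Thm. 1.1 — `KnafKuhlmann2005Thm34Stability.lean`;

down to four named facts, assembled in `KnafKuhlmann2009Leaves.lean`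
(`KnafKuhlmann2009.of_leaves`), each of which is now DISCHARGED in the tree:

* `Kuhlmann2019_Prop52_sepClosed_holds` (`Kuhlmann2019Prop52SepClosedHolds.lean`) — Kuhlmann
  2019, Prop. 5.2 (rank-one henselian rationality over separable-algebraically closed fields);
* `Kuhlmann2010SeparablyDefectlessRational_sepClosed_holds`
  (`SeparablyDefectlessRationalVTHolds.lean`) and
  `Kuhlmann2010SeparablyDefectlessRationalRT_sepClosed_holds`
  (`SeparablyDefectlessRationalRTProofs.lean`) — Kuhlmann 2010, Thm. 1.1, separably-defectless
  clause for value-transcendental / residue-transcendental generators;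
* `Kuhlmann2010Stability_holds` (`GeneralizedStabilityHolds.lean`) — Kuhlmann 2010, Thm. 1.1
  (Generalized Stability Theorem).

## Content (everything PROVED; no definition, no named fact)

* `KnafKuhlmann2009_holds` — **the discharge of `KnafKuhlmann2009`.**

## Sources

* [KK09] H. Knaf, F.-V. Kuhlmann, Adv. Math. 221 (2009) 428–453 = arXiv:math/0702856: Thm. 1.2
  (§1, proof §4.2); Thm. 1.1 (§1, proof §4.1); Lemma 3.7 (§3.2); Thm. 3.8 and Prop. 3.10 (§3.3).
  [KnafKuhlmann2009]
* [KK05] H. Knaf, F.-V. Kuhlmann, Ann. Sci. École Norm. Sup. (4) 38 (2005) 833–846: Thms. 1.1, 3.4.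
  [KnafKuhlmann2005]
* [K7] F.-V. Kuhlmann, *Elimination of ramification I: the generalized stability theorem*,
  Trans. Amer. Math. Soc. 362 (2010) 5697–5727: Thm. 1.1. [Kuhlmann2010]
* [K8] F.-V. Kuhlmann, *Elimination of ramification II: Henselian rationality*, Israel J. Math.
  234 (2019) 927–958 = arXiv:1701.05508: Thm. 1.3, Prop. 5.2. [Kuhlmann2019]
-/

noncomputable section

namespace Literature.AlgebraicGeometry.Resolution

universe u

/-- **DISCHARGE of `KnafKuhlmann2009`** (Knaf–Kuhlmann 2009, Thm. 1.2 — every place of a function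
field `F|K` admits smooth local uniformization in a finite extension of `F` — in the vendored weak
form: for `K/k` finitely generated and a valuation ring `O ⊇ k` of `K` there are a finite extension
`L/K` and a valuation ring `O'` of `L` over `O` that is locally uniformizable over `k`).  The
assembly `KnafKuhlmann2009.of_leaves`
(`KnafKuhlmann2009Leaves.lean`: §4.2 + §4.1 + Prop. 3.10 + [KK05] Thm. 3.4, all proved in the
tree) applied to the four discharged leaves `Kuhlmann2019_Prop52_sepClosed_holds`,
`Kuhlmann2010SeparablyDefectlessRational_sepClosed_holds`,
`Kuhlmann2010SeparablyDefectlessRationalRT_sepClosed_holds`, `Kuhlmann2010Stability_holds`.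
PROVED. [cite: KnafKuhlmann2009, Thm. 1.2 (proof: §4.2)] -/
theorem KnafKuhlmann2009_holds : KnafKuhlmann2009.{u} :=
  KnafKuhlmann2009.of_leaves Kuhlmann2019_Prop52_sepClosed_holds
    Kuhlmann2010SeparablyDefectlessRational_sepClosed_holds
    Kuhlmann2010SeparablyDefectlessRationalRT_sepClosed_holds Kuhlmann2010Stability_holds

end Literature.AlgebraicGeometry.Resolution

end
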